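import Literature.MathematicalPhysics.QuantumManyBody.CubicTrialVectorCubicTerms
import HarnessLib

/-!
# Coincidence families of triples: reduction of the coincidence sums to two slot families

Topic `Literature/MathematicalPhysics/QuantumManyBody`, namespace `BoseGas.Fock`; theorem-only, for the
provefact `Literature.MathematicalPhysics.QuantumManyBody.BoseGas.BastiCenatiempoSchlein2021_upperBound`.

The coincidence relations `C₁(τ,τ')` (two triples) and `C₂(τ,τⱼ,τₖ)` (three triples) of
`TripleAdm.coincidence_of_incompatible` single out, for the running triple `τ`, either its soft
mode `b` or one of its hard modes. Accordingly every coincidence sum is bounded by the two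
**slot families**

* `softFamily g b₀ = ∑_{τ : τ.b = b₀} g_τ` (the hard mode `u` runs, `a` is determined), and
* `hardFamily g p₀ = ∑_{τ : τ.u = p₀ ∨ τ.a = p₀} g_τ` (the soft mode runs):

`sum_ite_C₁_le`: `∑_τ [C₁(τ,τ')] g_τ ≤ 3 sup_b softFamily + 3 sup_p hardFamily`, and
`sum_weighted_C₂_le`: `∑_{τⱼ,τₖ}|κⱼ|²|κₖ|² ∑_τ[C₂] g_τ ≤ (sup softFamily)·∑_{τⱼ,τₖ}|κⱼ|²|κₖ|² #{(pⱼ,pₖ) : e pⱼ + e pₖ ∈ -e(P_S)} + 2(sup hardFamily)K₁²`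
— the counting behind (5.16)–(5.17) and (W₁)–(W₄) of [BastiCenatiempoSchlein2021]. The families
themselves are bounded by sums over one slot (`softFamily_le`, `hardFamily_le`).

## References

* [BastiCenatiempoSchlein2021] G. Basti, S. Cenatiempo, B. Schlein, Forum Math. Sigma 9 (2021) e74,
  arXiv:2101.06222: §5.2 (5.16)–(5.17), §5.3 (W₁)–(W₄).
-/

noncomputable section

namespace Literature.MathematicalPhysics.QuantumManyBody.BoseGas

open Complex MvPolynomial Finset
open scoped ComplexConjugate BigOperators

namespace Fock

variable {ι : Type*} [DecidableEq ι] [LinearOrder ι] [Fintype ι] {e : ι → Momentum} {PH PS : Finset ι}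

/-! ### The two slot families -/

/-- **The soft family is a sum over the running hard mode**: if `g_τ ≤ φ(τ.u)` on `{τ.b = b₀}` then
`∑_{τ : τ.b = b₀} g_τ ≤ ∑_{u ∈ P_H} φ(u)` (`τ ↦ τ.u` is injective on the family). [folklore] -/
theorem softFamily_le (he : Function.Injective e) (g : Triple e PH PS → ℝ) (b₀ : ι)
    (φ : ι → ℝ) (hφ0 : ∀ u ∈ PH, 0 ≤ φ u) (hφ : ∀ τ : Triple e PH PS, τ.b = b₀ → g τ ≤ φ τ.u) :
    ∑ τ : Triple e PH PS, (if τ.b = b₀ then g τ else 0) ≤ ∑ u ∈ PH, φ u := by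
  classical
  rw [← Finset.sum_filter]
  set F := Finset.univ.filter (fun τ : Triple e PH PS => τ.b = b₀) with hF
  have hinj : Set.InjOn (fun τ : Triple e PH PS => τ.u) F := by
    intro τ hτ τ' hτ' h
    rw [hF, Finset.coe_filter] at hτ hτ'
    have hb : τ.b = τ'.b := hτ.2.trans hτ'.2.symm
    have ha : τ.a = τ'.a := by
      apply he
      have h1 := τ.prop.2.2.2.1; have h2 := τ'.prop.2.2.2.1
      simp only at h
      rw [h, hb] at h1
      exact add_left_cancel (add_right_cancel (h1.trans h2.symm))
    exact Triple.ext' h ha hb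
  calc ∑ τ ∈ F, g τ ≤ ∑ τ ∈ F, φ τ.u := Finset.sum_le_sum fun τ hτ => hφ τ (Finset.mem_filter.1 hτ).2
    _ = ∑ u ∈ F.image (fun τ : Triple e PH PS => τ.u), φ u := (Finset.sum_image hinj).symm
    _ ≤ ∑ u ∈ PH, φ u := by
        refine Finset.sum_le_sum_of_subset_of_nonneg (fun u hu => ?_) (fun u hu _ => hφ0 u hu)
        rw [Finset.mem_image] at hu
        obtain ⟨τ, -, rfl⟩ := hu
        exact τ.prop.1

/-- **The hard family is two sums over the running soft mode**: if `g_τ ≤ φ₁(τ.b)` on `{τ.u = p₀}` and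
`g_τ ≤ φ₂(τ.b)` on `{τ.a = p₀}` then `∑_{τ : τ.u = p₀ ∨ τ.a = p₀} g_τ ≤ ∑_{b∈P_S}φ₁ + ∑_{b∈P_S}φ₂`. [folklore] -/
theorem hardFamily_le (he : Function.Injective e) (g : Triple e PH PS → ℝ) (hg : ∀ τ, 0 ≤ g τ) (p₀ : ι)
    (φ₁ φ₂ : ι → ℝ) (hφ₁0 : ∀ b ∈ PS, 0 ≤ φ₁ b) (hφ₂0 : ∀ b ∈ PS, 0 ≤ φ₂ b)
    (hφ₁ : ∀ τ : Triple e PH PS, τ.u = p₀ → g τ ≤ φ₁ τ.b) (hφ₂ : ∀ τ : Triple e PH PS, τ.a = p₀ → g τ ≤ φ₂ τ.b) :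
    ∑ τ : Triple e PH PS, (if τ.u = p₀ ∨ τ.a = p₀ then g τ else 0) ≤ ∑ b ∈ PS, φ₁ b + ∑ b ∈ PS, φ₂ b := by
  classical
  -- split the indicator
  have hsplit : ∀ τ : Triple e PH PS, (if τ.u = p₀ ∨ τ.a = p₀ then g τ else 0) ≤
      (if τ.u = p₀ then g τ else 0) + (if τ.a = p₀ then g τ else 0) := by
    intro τ
    by_cases h1 : τ.u = p₀ <;> by_cases h2 : τ.a = p₀ <;> simp [h1, h2, hg τ]
  refine (Finset.sum_le_sum fun τ _ => hsplit τ).trans ?_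
  rw [Finset.sum_add_distrib]
  refine add_le_add ?_ ?_
  · rw [← Finset.sum_filter]
    set F := Finset.univ.filter (fun τ : Triple e PH PS => τ.u = p₀) with hF
    have hinj : Set.InjOn (fun τ : Triple e PH PS => τ.b) F := by
      intro τ hτ τ' hτ' h
      rw [hF, Finset.coe_filter] at hτ hτ'
      have hu : τ.u = τ'.u := hτ.2.trans hτ'.2.symm
      have ha : τ.a = τ'.a := by
        apply he
        have h1 := τ.prop.2.2.2.1; have h2 := τ'.prop.2.2.2.1
        simp only at h
        rw [h, hu] at h1
        exact add_left_cancel (add_right_cancel (h1.trans h2.symm))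
      exact Triple.ext' hu ha h
    calc ∑ τ ∈ F, g τ ≤ ∑ τ ∈ F, φ₁ τ.b := Finset.sum_le_sum fun τ hτ => hφ₁ τ (Finset.mem_filter.1 hτ).2
      _ = ∑ b ∈ F.image (fun τ : Triple e PH PS => τ.b), φ₁ b := (Finset.sum_image hinj).symm
      _ ≤ ∑ b ∈ PS, φ₁ b := by
          refine Finset.sum_le_sum_of_subset_of_nonneg (fun b hb => ?_) (fun b hb _ => hφ₁0 b hb)
          rw [Finset.mem_image] at hb
          obtain ⟨τ, -, rfl⟩ := hb
          exact τ.prop.2.2.1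
  · rw [← Finset.sum_filter]
    set F := Finset.univ.filter (fun τ : Triple e PH PS => τ.a = p₀) with hF
    have hinj : Set.InjOn (fun τ : Triple e PH PS => τ.b) F := by
      intro τ hτ τ' hτ' h
      rw [hF, Finset.coe_filter] at hτ hτ'
      have ha : τ.a = τ'.a := hτ.2.trans hτ'.2.symm
      have hu : τ.u = τ'.u := by
        apply he
        have h1 := τ.prop.2.2.2.1; have h2 := τ'.prop.2.2.2.1
        simp only at h
        rw [h, ha] at h1
        have h3 := h1.trans h2.symm
        rw [add_assoc, add_assoc] at h3
        exact add_right_cancel h3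
      exact Triple.ext' hu ha h
    calc ∑ τ ∈ F, g τ ≤ ∑ τ ∈ F, φ₂ τ.b := Finset.sum_le_sum fun τ hτ => hφ₂ τ (Finset.mem_filter.1 hτ).2
      _ = ∑ b ∈ F.image (fun τ : Triple e PH PS => τ.b), φ₂ b := (Finset.sum_image hinj).symm
      _ ≤ ∑ b ∈ PS, φ₂ b := by
          refine Finset.sum_le_sum_of_subset_of_nonneg (fun b hb => ?_) (fun b hb _ => hφ₂0 b hb)
          rw [Finset.mem_image] at hb
          obtain ⟨τ, -, rfl⟩ := hb
          exact τ.prop.2.2.1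

/-! ### The coincidence sums reduced to the families -/

/-- **Two-index coincidences**: with `GB ≥ sup_b ∑_{τ.b = b} g`, `GH ≥ sup_p ∑_{τ.u = p ∨ τ.a = p} g`,
`∑_τ [C₁(τ,τ')] g_τ ≤ 3GB + 3GH` for every `τ'`. [cite: BastiCenatiempoSchlein2021, §5.2 (5.16)] -/
theorem sum_ite_C₁_le (he : Function.Injective e) (g : Triple e PH PS → ℝ) (hg : ∀ τ, 0 ≤ g τ) {GB GH : ℝ}
    (hGB : ∀ b₀ : ι, ∑ τ : Triple e PH PS, (if τ.b = b₀ then g τ else 0) ≤ GB)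
    (hGH : ∀ p₀ : ι, ∑ τ : Triple e PH PS, (if τ.u = p₀ ∨ τ.a = p₀ then g τ else 0) ≤ GH)
    (τ' : Triple e PH PS) :
    ∑ τ : Triple e PH PS,
      (if τ.b = τ'.b ∨ (∃ p, (p = τ.u ∨ p = τ.a) ∧ (p = τ'.u ∨ p = τ'.a)) ∨
          (∃ p, (p = τ.u ∨ p = τ.a) ∧ e p + e p + e τ'.b = 0) ∨ (∃ p', (p' = τ'.u ∨ p' = τ'.a) ∧ e p' + e p' + e τ.b = 0)
        then g τ else 0) ≤ 3 * GB + 3 * GH := by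
  classical
  have hGB0 : 0 ≤ GB := le_trans (Finset.sum_nonneg fun τ _ => by split_ifs <;> [exact hg τ; exact le_rfl]) (hGB τ'.b)
  have hGH0 : 0 ≤ GH := le_trans (Finset.sum_nonneg fun τ _ => by split_ifs <;> [exact hg τ; exact le_rfl]) (hGH τ'.u)
  -- the five families
  set I₁ : Triple e PH PS → ℝ := fun τ => if τ.b = τ'.b then g τ else 0 with hI₁
  set I₂ : Triple e PH PS → ℝ := fun τ => if τ.u = τ'.u ∨ τ.a = τ'.u then g τ else 0 with hI₂
  set I₃ : Triple e PH PS → ℝ := fun τ => if τ.u = τ'.a ∨ τ.a = τ'.a then g τ else 0 with hI₃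
  set I₄ : Triple e PH PS → ℝ := fun τ => if (∃ p, (p = τ.u ∨ p = τ.a) ∧ e p + e p + e τ'.b = 0) then g τ else 0 with hI₄
  set I₅ : Triple e PH PS → ℝ := fun τ => if e τ'.u + e τ'.u + e τ.b = 0 then g τ else 0 with hI₅
  set I₆ : Triple e PH PS → ℝ := fun τ => if e τ'.a + e τ'.a + e τ.b = 0 then g τ else 0 with hI₆
  have hI0 : ∀ τ : Triple e PH PS, 0 ≤ I₁ τ ∧ 0 ≤ I₂ τ ∧ 0 ≤ I₃ τ ∧ 0 ≤ I₄ τ ∧ 0 ≤ I₅ τ ∧ 0 ≤ I₆ τ := by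
    intro τ
    have := hg τ
    refine ⟨?_, ?_, ?_, ?_, ?_, ?_⟩ <;> simp only [hI₁, hI₂, hI₃, hI₄, hI₅, hI₆] <;> split_ifs <;> linarith
  have hpt : ∀ τ : Triple e PH PS,
      (if τ.b = τ'.b ∨ (∃ p, (p = τ.u ∨ p = τ.a) ∧ (p = τ'.u ∨ p = τ'.a)) ∨
          (∃ p, (p = τ.u ∨ p = τ.a) ∧ e p + e p + e τ'.b = 0) ∨ (∃ p', (p' = τ'.u ∨ p' = τ'.a) ∧ e p' + e p' + e τ.b = 0)
        then g τ else 0) ≤ I₁ τ + I₂ τ + I₃ τ + I₄ τ + I₅ τ + I₆ τ := by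
    intro τ
    obtain ⟨h01, h02, h03, h04, h05, h06⟩ := hI0 τ
    split_ifs with h
    · rcases h with hb | ⟨p, hp, hp'⟩ | h4 | ⟨p', hp', hsum⟩
      · have : I₁ τ = g τ := if_pos hb
        linarith
      · rcases hp' with rfl | rfl
        · have : I₂ τ = g τ := if_pos (by rcases hp with h | h <;> [exact Or.inl h.symm; exact Or.inr h.symm])
          linarith
        · have : I₃ τ = g τ := if_pos (by rcases hp with h | h <;> [exact Or.inl h.symm; exact Or.inr h.symm])
          linarith
      · have : I₄ τ = g τ := if_pos h4
        linarith
      · rcases hp' with rfl | rfl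
        · have : I₅ τ = g τ := if_pos hsum
          linarith
        · have : I₆ τ = g τ := if_pos hsum
          linarith
    · linarith
  -- bound each family
  have h1 : ∑ τ, I₁ τ ≤ GB := hGB τ'.b
  have h2 : ∑ τ, I₂ τ ≤ GH := hGH τ'.u
  have h3 : ∑ τ, I₃ τ ≤ GH := hGH τ'.a
  have h4 : ∑ τ, I₄ τ ≤ GH := by
    by_cases hex : ∃ p : ι, e p + e p + e τ'.b = 0
    · obtain ⟨p₀, hp₀⟩ := hex
      have heq : ∀ τ : Triple e PH PS, I₄ τ = (if τ.u = p₀ ∨ τ.a = p₀ then g τ else 0) := by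
        intro τ
        simp only [hI₄]
        congr 1
        apply propext
        constructor
        · rintro ⟨p, hp, hsum⟩
          have : p = p₀ := he (by
            have h2 : e p + e p = e p₀ + e p₀ := add_right_cancel (hsum.trans hp₀.symm)
            funext j
            have := congrFun h2 j
            simp only [Pi.add_apply] at this
            omega)
          subst this
          rcases hp with h | h <;> [exact Or.inl h.symm; exact Or.inr h.symm]
        · rintro (h | h)
          · exact ⟨τ.u, Or.inl rfl, h ▸ hp₀⟩
          · exact ⟨τ.a, Or.inr rfl, h ▸ hp₀⟩
      simp only [heq]
      exact hGH p₀
    · have : ∀ τ : Triple e PH PS, I₄ τ = 0 := fun τ => if_neg (fun ⟨p, _, hsum⟩ => hex ⟨p, hsum⟩)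
      simp only [this, Finset.sum_const_zero]
      exact hGH0
  have h5 : ∑ τ, I₅ τ ≤ GB := by
    by_cases hex : ∃ b : ι, e τ'.u + e τ'.u + e b = 0
    · obtain ⟨b₀, hb₀⟩ := hex
      have heq : ∀ τ : Triple e PH PS, I₅ τ = (if τ.b = b₀ then g τ else 0) := by
        intro τ
        simp only [hI₅]
        congr 1
        apply propext
        constructor
        · intro h; exact he (add_left_cancel (h.trans hb₀.symm))
        · intro h; rw [h]; exact hb₀
      simp only [heq]; exact hGB b₀
    · have : ∀ τ : Triple e PH PS, I₅ τ = 0 := fun τ => if_neg (fun h => hex ⟨τ.b, h⟩)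
      simp only [this, Finset.sum_const_zero]; exact hGB0
  have h6 : ∑ τ, I₆ τ ≤ GB := by
    by_cases hex : ∃ b : ι, e τ'.a + e τ'.a + e b = 0
    · obtain ⟨b₀, hb₀⟩ := hex
      have heq : ∀ τ : Triple e PH PS, I₆ τ = (if τ.b = b₀ then g τ else 0) := by
        intro τ
        simp only [hI₆]
        congr 1
        apply propext
        constructor
        · intro h; exact he (add_left_cancel (h.trans hb₀.symm))
        · intro h; rw [h]; exact hb₀
      simp only [heq]; exact hGB b₀
    · have : ∀ τ : Triple e PH PS, I₆ τ = 0 := fun τ => if_neg (fun h => hex ⟨τ.b, h⟩)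
      simp only [this, Finset.sum_const_zero]; exact hGB0
  calc _ ≤ ∑ τ, (I₁ τ + I₂ τ + I₃ τ + I₄ τ + I₅ τ + I₆ τ) := Finset.sum_le_sum fun τ _ => hpt τ
    _ = ∑ τ, I₁ τ + ∑ τ, I₂ τ + ∑ τ, I₃ τ + ∑ τ, I₄ τ + ∑ τ, I₅ τ + ∑ τ, I₆ τ := by
        simp only [Finset.sum_add_distrib]
    _ ≤ GB + GH + GH + GH + GB + GB := by linarith
    _ = 3 * GB + 3 * GH := by ring

/-- **Three-index coincidences, weighted**: with the families as in `sum_ite_C₁_le` and the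
near-antipodal count `Z(pⱼ,pₖ) = [∃ b : e pⱼ + e pₖ + e b = 0 ∧ (some triple has soft mode b)]`
replaced by the cruder `[∃ b, e pⱼ + e pₖ + e b = 0 with a triple τ, τ.b = b]`-free bound through `GB`:
`∑_{τⱼ,τₖ}|κⱼ|²|κₖ|² ∑_τ [C₂(τ,τⱼ,τₖ)] g_τ ≤ GB·∑_{τⱼ,τₖ}|κⱼ|²|κₖ|² N(τⱼ,τₖ) + 2GH(∑|κ|²)²`, where
`N(τⱼ,τₖ) = #{(pⱼ,pₖ) ∈ {uⱼ,aⱼ}×{uₖ,aₖ} : ∃ τ, e pⱼ + e pₖ + e τ.b = 0}` (at most `4`, and `0` unless the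
two hard modes are nearly antipodal). [cite: BastiCenatiempoSchlein2021, §5.2 (5.17), §5.3 (W₃)–(W₄)] -/
theorem sum_weighted_C₂_le (he : Function.Injective e) (κ : Triple e PH PS → ℂ) (g : Triple e PH PS → ℝ)
    (hg : ∀ τ, 0 ≤ g τ) {GB GH : ℝ}
    (hGB : ∀ b₀ : ι, ∑ τ : Triple e PH PS, (if τ.b = b₀ then g τ else 0) ≤ GB)
    (hGH : ∀ p₀ : ι, ∑ τ : Triple e PH PS, (if τ.u = p₀ ∨ τ.a = p₀ then g τ else 0) ≤ GH) :
    ∑ τj : Triple e PH PS, ∑ τk : Triple e PH PS, ‖κ τj‖ ^ 2 * ‖κ τk‖ ^ 2 * ∑ τ : Triple e PH PS,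
      (if (∃ pj pk, (pj = τj.u ∨ pj = τj.a) ∧ (pk = τk.u ∨ pk = τk.a) ∧ e pj + e pk + e τ.b = 0) ∨
          (∃ p pk, (p = τ.u ∨ p = τ.a) ∧ (pk = τk.u ∨ pk = τk.a) ∧ e p + e pk + e τj.b = 0)
        then g τ else 0) ≤
      GB * ∑ τj : Triple e PH PS, ∑ τk : Triple e PH PS, ‖κ τj‖ ^ 2 * ‖κ τk‖ ^ 2 *
        (((if ∃ b ∈ PS, e τj.u + e τk.u + e b = 0 then (1 : ℝ) else 0) + (if ∃ b ∈ PS, e τj.u + e τk.a + e b = 0 then 1 else 0)) +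
          ((if ∃ b ∈ PS, e τj.a + e τk.u + e b = 0 then 1 else 0) + (if ∃ b ∈ PS, e τj.a + e τk.a + e b = 0 then 1 else 0))) +
      2 * GH * (∑ τ : Triple e PH PS, ‖κ τ‖ ^ 2) ^ 2 := by
  classical
  -- per pair `(τj, τk)`
  have hpair : ∀ τj τk : Triple e PH PS, ∑ τ : Triple e PH PS,
      (if (∃ pj pk, (pj = τj.u ∨ pj = τj.a) ∧ (pk = τk.u ∨ pk = τk.a) ∧ e pj + e pk + e τ.b = 0) ∨
          (∃ p pk, (p = τ.u ∨ p = τ.a) ∧ (pk = τk.u ∨ pk = τk.a) ∧ e p + e pk + e τj.b = 0)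
        then g τ else 0) ≤
      GB * (((if ∃ b ∈ PS, e τj.u + e τk.u + e b = 0 then (1 : ℝ) else 0) + (if ∃ b ∈ PS, e τj.u + e τk.a + e b = 0 then 1 else 0)) +
          ((if ∃ b ∈ PS, e τj.a + e τk.u + e b = 0 then 1 else 0) + (if ∃ b ∈ PS, e τj.a + e τk.a + e b = 0 then 1 else 0))) +
        2 * GH := by
    intro τj τk
    have hGH0 : 0 ≤ GH :=
      le_trans (Finset.sum_nonneg fun τ _ => by split_ifs <;> [exact hg τ; exact le_rfl]) (hGH τj.u)
    -- the soft families indexed by the four pairs and the hard families indexed by the two `pk`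
    set J : ι → ι → Triple e PH PS → ℝ := fun pj pk τ => if e pj + e pk + e τ.b = 0 then g τ else 0 with hJ
    set Hk : ι → Triple e PH PS → ℝ := fun pk τ => if (∃ p, (p = τ.u ∨ p = τ.a) ∧ e p + e pk + e τj.b = 0) then g τ else 0 with hHk
    have hpt : ∀ τ : Triple e PH PS,
        (if (∃ pj pk, (pj = τj.u ∨ pj = τj.a) ∧ (pk = τk.u ∨ pk = τk.a) ∧ e pj + e pk + e τ.b = 0) ∨
            (∃ p pk, (p = τ.u ∨ p = τ.a) ∧ (pk = τk.u ∨ pk = τk.a) ∧ e p + e pk + e τj.b = 0)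
          then g τ else 0) ≤
        (J τj.u τk.u τ + J τj.u τk.a τ + J τj.a τk.u τ + J τj.a τk.a τ) + (Hk τk.u τ + Hk τk.a τ) := by
      intro τ
      have hJ0 : ∀ pj pk, 0 ≤ J pj pk τ := fun pj pk => by simp only [hJ]; split_ifs <;> [exact hg τ; exact le_rfl]
      have hH0 : ∀ pk, 0 ≤ Hk pk τ := fun pk => by simp only [hHk]; split_ifs <;> [exact hg τ; exact le_rfl]
      have h0 : 0 ≤ (J τj.u τk.u τ + J τj.u τk.a τ + J τj.a τk.u τ + J τj.a τk.a τ) + (Hk τk.u τ + Hk τk.a τ) := by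
        have := hJ0 τj.u τk.u; have := hJ0 τj.u τk.a; have := hJ0 τj.a τk.u; have := hJ0 τj.a τk.a
        have := hH0 τk.u; have := hH0 τk.a; linarith
      split_ifs with h
      · rcases h with ⟨pj, pk, hpj, hpk, hsum⟩ | ⟨p, pk, hp, hpk, hsum⟩
        · have hval : J pj pk τ = g τ := if_pos hsum
          have := hJ0 τj.u τk.u; have := hJ0 τj.u τk.a; have := hJ0 τj.a τk.u; have := hJ0 τj.a τk.a
          have := hH0 τk.u; have := hH0 τk.a
          rcases hpj with rfl | rfl <;> rcases hpk with rfl | rfl <;> linarith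
        · have hval : Hk pk τ = g τ := if_pos ⟨p, hp, hsum⟩
          have := hJ0 τj.u τk.u; have := hJ0 τj.u τk.a; have := hJ0 τj.a τk.u; have := hJ0 τj.a τk.a
          have := hH0 τk.u; have := hH0 τk.a
          rcases hpk with rfl | rfl <;> linarith
      · exact h0
    -- the soft families
    have hJle : ∀ pj pk : ι, ∑ τ, J pj pk τ ≤ GB * (if ∃ b ∈ PS, e pj + e pk + e b = 0 then (1 : ℝ) else 0) := by
      intro pj pk
      by_cases hex : ∃ b ∈ PS, e pj + e pk + e b = 0
      · rw [if_pos hex, mul_one]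
        obtain ⟨b₀, -, hb₀⟩ := hex
        have heq : ∀ τ : Triple e PH PS, J pj pk τ = (if τ.b = b₀ then g τ else 0) := by
          intro τ
          simp only [hJ]
          congr 1
          apply propext
          constructor
          · intro h; exact he (add_left_cancel (h.trans hb₀.symm))
          · intro h; rw [h]; exact hb₀
        simp only [heq]; exact hGB b₀
      · rw [if_neg hex, mul_zero]
        have : ∀ τ : Triple e PH PS, J pj pk τ = 0 := fun τ => if_neg (fun h => hex ⟨τ.b, τ.prop.2.2.1, h⟩)
        simp only [this, Finset.sum_const_zero]; exact le_rfl
    -- the hard families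
    have hHle : ∀ pk : ι, ∑ τ, Hk pk τ ≤ GH := by
      intro pk
      by_cases hex : ∃ p : ι, e p + e pk + e τj.b = 0
      · obtain ⟨p₀, hp₀⟩ := hex
        have heq : ∀ τ : Triple e PH PS, Hk pk τ = (if τ.u = p₀ ∨ τ.a = p₀ then g τ else 0) := by
          intro τ
          simp only [hHk]
          congr 1
          apply propext
          constructor
          · rintro ⟨p, hp, hsum⟩
            have : p = p₀ := he (add_right_cancel (add_right_cancel (hsum.trans hp₀.symm)))
            subst this
            rcases hp with h | h <;> [exact Or.inl h.symm; exact Or.inr h.symm]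
          · rintro (h | h)
            · exact ⟨τ.u, Or.inl rfl, h ▸ hp₀⟩
            · exact ⟨τ.a, Or.inr rfl, h ▸ hp₀⟩
        simp only [heq]; exact hGH p₀
      · have : ∀ τ : Triple e PH PS, Hk pk τ = 0 := fun τ => if_neg (fun ⟨p, _, hsum⟩ => hex ⟨p, hsum⟩)
        simp only [this, Finset.sum_const_zero]; exact hGH0
    calc _ ≤ ∑ τ, ((J τj.u τk.u τ + J τj.u τk.a τ + J τj.a τk.u τ + J τj.a τk.a τ) + (Hk τk.u τ + Hk τk.a τ)) :=
          Finset.sum_le_sum fun τ _ => hpt τ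
      _ = (∑ τ, J τj.u τk.u τ + ∑ τ, J τj.u τk.a τ + ∑ τ, J τj.a τk.u τ + ∑ τ, J τj.a τk.a τ) +
            (∑ τ, Hk τk.u τ + ∑ τ, Hk τk.a τ) := by simp only [Finset.sum_add_distrib]
      _ ≤ (GB * (if ∃ b ∈ PS, e τj.u + e τk.u + e b = 0 then (1 : ℝ) else 0) +
            GB * (if ∃ b ∈ PS, e τj.u + e τk.a + e b = 0 then (1 : ℝ) else 0) +
            GB * (if ∃ b ∈ PS, e τj.a + e τk.u + e b = 0 then (1 : ℝ) else 0) +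
            GB * (if ∃ b ∈ PS, e τj.a + e τk.a + e b = 0 then (1 : ℝ) else 0)) + (GH + GH) :=
          add_le_add (add_le_add (add_le_add (add_le_add (hJle _ _) (hJle _ _)) (hJle _ _)) (hJle _ _))
            (add_le_add (hHle _) (hHle _))
      _ = _ := by ring
  -- sum over the pairs
  calc _ ≤ ∑ τj : Triple e PH PS, ∑ τk : Triple e PH PS, ‖κ τj‖ ^ 2 * ‖κ τk‖ ^ 2 *
        (GB * (((if ∃ b ∈ PS, e τj.u + e τk.u + e b = 0 then (1 : ℝ) else 0) + (if ∃ b ∈ PS, e τj.u + e τk.a + e b = 0 then 1 else 0)) +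
            ((if ∃ b ∈ PS, e τj.a + e τk.u + e b = 0 then 1 else 0) + (if ∃ b ∈ PS, e τj.a + e τk.a + e b = 0 then 1 else 0))) +
          2 * GH) :=
        Finset.sum_le_sum fun τj _ => Finset.sum_le_sum fun τk _ => mul_le_mul_of_nonneg_left (hpair τj τk) (by positivity)
    _ = _ := by
        rw [sq (∑ τ : Triple e PH PS, ‖κ τ‖ ^ 2), Finset.sum_mul_sum, Finset.mul_sum, Finset.mul_sum, ← Finset.sum_add_distrib]
        refine Finset.sum_congr rfl fun τj _ => ?_
        rw [Finset.mul_sum, Finset.mul_sum, ← Finset.sum_add_distrib]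
        exact Finset.sum_congr rfl fun τk _ => by ring

end Fock

end Literature.MathematicalPhysics.QuantumManyBody.BoseGas

end
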